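import Literature.Topology.PlaneTopology.PolygonUmlaufsatz
import Mathlib.Analysis.Calculus.MeanValue
import Mathlib.Analysis.Calculus.Deriv.Shift
import Mathlib.Analysis.Calculus.ContDiff.Deriv
import Mathlib.Analysis.Calculus.LocalExtr.Basic
import Mathlib.Analysis.SpecialFunctions.Trigonometric.Inverse
import Mathlib.Analysis.SpecialFunctions.Complex.Arg
import Mathlib.Analysis.Complex.RealDeriv
import Mathlib.Topology.UniformSpace.HeineCantor
import Mathlib.Algebra.Order.ToIntervalMod
import HarnessLib

/-!
# Hopf's Umlaufsatz for regular closed curves of class `C¹`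

Topic: Topology / PlaneTopology (companion to `PolygonUmlaufsatz.lean`, whose secant argument and
increment calculus are reused here for smooth curves). H. Hopf, *Über die Drehung der Tangenten
und Sehnen ebener Kurven*, Compositio Math. 2 (1935) 50–62, Satz I; P. Hartman, *Ordinary
Differential Equations* (SIAM Classics 38, 2002), Ch. VII, Thm. 2.1 (Umlaufsatz): *the tangent of
a simple closed plane curve of class `C¹` turns by `±2π`.*

The curve is an `L`-periodic map `γ : ℝ → ℂ` of class `C¹` with nowhere-vanishing derivative,
injective modulo the period (`γ s = γ t → t - s ∈ ℤ L`); the conclusion is that the loop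
`u ↦ γ' (L u)` (`u ∈ [0, 1]`) in `ℂ \ {0}` has winding number `1` or `-1` about the origin
(`wind_deriv_eq_one_or_eq_neg_one`; `Literature.Topology.PlaneTopology.wind` of
`WindingNumber.lean`).

* `wind_deriv_eq_one_of_lowest` — the normalised statement (Hartman's proof of Thm. VII.2.1):
  if `γ 0` is a lowest point of the curve and `γ' 0` points in the positive real direction, the
  winding number is `1`. Proof: the secant map `S (s, t) = γ t - γ s` is continuous and nowhere
  zero on the open convex strip `U = {0 < t - s < L}` (injectivity modulo the period), hence has
  a continuous logarithm there (`hasLogOn_secant`); the increments of this logarithm along the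
  closed chain `(0, ε) → (0, L-ε) → (ε, L) → (L-ε, L) → (0, ε)` (`ε` small) sum to zero. Along
  the two legs the secants `γ t - γ 0` and `γ 0 - γ s` stay in the closed upper half-plane, and
  each leg contributes an argument increment within `π/3` of `π`; the short side contributes at
  most `π/3`; and along the line `t - s = ε` the secant is `γ (s+ε) - γ s = ε γ'(s) ρ(s)` with
  `|ρ(s) - 1| ≤ 1/4` (uniform continuity of `γ'` and the mean value inequality), so its argument
  increment is `2π · wind` up to at most `π/2`. Comparing imaginary parts pins the winding number
  to `1`.
* `wind_deriv_eq_one_or_eq_neg_one` — **the Umlaufsatz**: general case, by moving the parameter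
  origin to a lowest point (the winding number of a periodic loop is invariant under translation
  of the parameter, `wind_comp_add_of_periodic`) and reversing the orientation if necessary
  (`wind_comp_one_sub`).
* `wind_eq_wind_deriv_of_div_mem_slitPlane`, `wind_eq_one_or_eq_neg_one_of_div_mem_slitPlane` —
  Hartman's Lemma VII.2.1 in the form used for vector fields: a continuous `L`-periodic field `V`
  along the curve which is never opposite to the tangent (`V t / γ' t ∉ (-∞, 0]`) has the same
  winding number as the tangent, hence `±1`.

Everything here is proved; there are no definitions and no named facts (hypotheses are passed
explicitly). No Jordan curve theorem is used.

## References

* H. Hopf, *Über die Drehung der Tangenten und Sehnen ebener Kurven*, Compositio Math. 2 (1935)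
  50–62, Satz I. [Hopf1935]
* P. Hartman, *Ordinary Differential Equations*, Classics in Applied Mathematics 38, SIAM (2002),
  Ch. VII §2, Thm. 2.1 and Lemma 2.1 (held: `book:hartman2002-ordinary-differential-equations`,
  PDF pp. 144–146). [Hartman2002]
-/

noncomputable section

open Complex Set Filter Function Metric
open scoped Real Topology

namespace Literature.Topology.PlaneTopology

/-! ### Elementary estimates for arguments of numbers close to `1` -/

/-- `|arcsin x| ≤ π/6` for `|x| ≤ 1/2`. [folklore] -/
theorem abs_arcsin_le_pi_div_six {x : ℝ} (h : |x| ≤ 1 / 2) : |Real.arcsin x| ≤ π / 6 := by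
  have h6 : Real.arcsin (1 / 2) = π / 6 := by
    rw [← Real.sin_pi_div_six]
    exact Real.arcsin_sin (by linarith [Real.pi_pos]) (by linarith [Real.pi_pos])
  rw [abs_le]
  obtain ⟨h1, h2⟩ := abs_le.1 h
  constructor
  · have := Real.arcsin_le_arcsin h1
    rw [Real.arcsin_neg, h6] at this
    linarith
  · have := Real.arcsin_le_arcsin h2
    rwa [h6] at this

/-- `π/3 ≤ arccos x ≤ 2π/3` for `|x| ≤ 1/2`. [folklore] -/
theorem arccos_mem_Icc_of_abs_le {x : ℝ} (h : |x| ≤ 1 / 2) :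
    Real.arccos x ∈ Icc (π / 3) (2 * π / 3) := by
  have h1 := abs_le.1 (abs_arcsin_le_pi_div_six h)
  rw [Real.arccos_eq_pi_div_two_sub_arcsin]
  constructor <;> linarith [h1.1, h1.2]

/-- A complex number within `1/4` of `1` has real part `≥ 3/4`, imaginary part of size `≤ 1/4`,
norm `≥ 3/4`, and `|im| / norm ≤ 1/2`. [folklore] -/
theorem re_im_bounds_of_norm_sub_one_le {ζ : ℂ} (h : ‖ζ - 1‖ ≤ 1 / 4) :
    3 / 4 ≤ ζ.re ∧ |ζ.im| ≤ 1 / 4 ∧ 3 / 4 ≤ ‖ζ‖ ∧ |ζ.im| / ‖ζ‖ ≤ 1 / 2 := by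
  have hre : |ζ.re - 1| ≤ 1 / 4 := by
    have := abs_re_le_norm (ζ - 1); rw [sub_re, one_re] at this; linarith
  have him : |ζ.im| ≤ 1 / 4 := by
    have := abs_im_le_norm (ζ - 1); rw [sub_im, one_im, sub_zero] at this; linarith
  have hre' : 3 / 4 ≤ ζ.re := by have := (abs_le.1 hre).1; linarith
  have hnorm : 3 / 4 ≤ ‖ζ‖ := hre'.trans (re_le_norm ζ)
  refine ⟨hre', him, hnorm, ?_⟩
  rw [div_le_iff₀ (by linarith)]
  linarith

/-- **Numbers within `1/4` of `1` have argument at most `π/6` in size.** [folklore] -/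
theorem abs_arg_le_of_norm_sub_one_le {ζ : ℂ} (h : ‖ζ - 1‖ ≤ 1 / 4) : |arg ζ| ≤ π / 6 := by
  obtain ⟨hre, -, -, hq⟩ := re_im_bounds_of_norm_sub_one_le h
  rw [arg_of_re_nonneg (by linarith)]
  refine abs_arcsin_le_pi_div_six ?_
  rwa [abs_div, abs_norm]

/-- For `ζ` within `1/4` of `1`, the argument of `I ζ` lies within `π/6` of `π/2`. [folklore] -/
theorem arg_I_mul_mem_Icc {ζ : ℂ} (h : ‖ζ - 1‖ ≤ 1 / 4) : arg (I * ζ) ∈ Icc (π / 3) (2 * π / 3) := by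
  obtain ⟨hre, -, -, hq⟩ := re_im_bounds_of_norm_sub_one_le h
  have h1 : (I * ζ).im = ζ.re := by simp
  have h2 : (I * ζ).re = -ζ.im := by simp
  have h3 : ‖I * ζ‖ = ‖ζ‖ := by rw [norm_mul, norm_I, one_mul]
  rw [arg_of_im_pos (by rw [h1]; linarith), h2, h3]
  refine arccos_mem_Icc_of_abs_le ?_
  rwa [neg_div, abs_neg, abs_div, abs_norm]

/-- For `ζ` within `1/4` of `1`, the argument of `-I ζ` lies within `π/6` of `-π/2`. [folklore] -/
theorem arg_neg_I_mul_mem_Icc {ζ : ℂ} (h : ‖ζ - 1‖ ≤ 1 / 4) :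
    arg (-I * ζ) ∈ Icc (-(2 * π / 3)) (-(π / 3)) := by
  obtain ⟨hre, -, -, hq⟩ := re_im_bounds_of_norm_sub_one_le h
  have h1 : (-I * ζ).im = -ζ.re := by simp
  have h2 : (-I * ζ).re = ζ.im := by simp
  have h3 : ‖-I * ζ‖ = ‖ζ‖ := by rw [norm_mul, norm_neg, norm_I, one_mul]
  rw [arg_of_im_neg (by rw [h1]; linarith), h2, h3]
  have := arccos_mem_Icc_of_abs_le (x := ζ.im / ‖ζ‖) (by rwa [abs_div, abs_norm])
  constructor <;> linarith [this.1, this.2]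

/-- A number within `1/4` of `1` lies in the slit plane. [folklore] -/
theorem mem_slitPlane_of_norm_sub_one_le {ζ : ℂ} (h : ‖ζ - 1‖ ≤ 1 / 4) : ζ ∈ slitPlane :=
  Or.inl (by linarith [(re_im_bounds_of_norm_sub_one_le h).1])

/-- `‖a / b - 1‖ ≤ 1/4` as soon as `‖a - b‖ ≤ ‖b‖ / 4` (`b ≠ 0`). [folklore] -/
theorem norm_div_sub_one_le {a b : ℂ} (hb : b ≠ 0) (h : ‖a - b‖ ≤ ‖b‖ / 4) : ‖a / b - 1‖ ≤ 1 / 4 := by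
  have hb' : 0 < ‖b‖ := norm_pos_iff.2 hb
  rw [show a / b - 1 = (a - b) / b by field_simp, norm_div, div_le_iff₀ hb']
  linarith

/-! ### The mean value inequality against a constant velocity -/

/-- **Secants against a constant velocity.** If `‖γ' t - w‖ ≤ η` on `[a, b]` then
`‖γ b - γ a - (b - a) w‖ ≤ η (b - a)`. [folklore] -/
theorem norm_sub_sub_mul_le {γ γ' : ℝ → ℂ} (hd : ∀ t, HasDerivAt γ (γ' t) t) {a b : ℝ} (hab : a ≤ b)
    {w : ℂ} {η : ℝ} (hη : ∀ t ∈ Icc a b, ‖γ' t - w‖ ≤ η) :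
    ‖γ b - γ a - ((b - a : ℝ) : ℂ) * w‖ ≤ η * (b - a) := by
  have hgd : ∀ t, HasDerivAt (fun t => γ t - (t : ℂ) * w) (γ' t - w) t := by
    intro t
    have h1 : HasDerivAt (fun t : ℝ => (t : ℂ) * w) (((1 : ℝ) : ℂ) * w) t :=
      ((hasDerivAt_id t).ofReal_comp).mul_const w
    rw [ofReal_one, one_mul] at h1
    exact (hd t).sub h1
  have key := norm_image_sub_le_of_norm_deriv_le_segment' (f := fun t => γ t - (t : ℂ) * w)
    (f' := fun t => γ' t - w) (fun t _ => (hgd t).hasDerivWithinAt)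
    (fun t ht => hη t (Ico_subset_Icc_self ht)) b (right_mem_Icc.2 hab)
  have e : (γ b - (b : ℂ) * w) - (γ a - (a : ℂ) * w) = γ b - γ a - ((b - a : ℝ) : ℂ) * w := by
    push_cast; ring
  rwa [e] at key

/-! ### Winding numbers of periodic loops: translation and reversal of the parameter -/

/-- **Translating the parameter of a periodic loop does not change its winding number.** For
`f : ℝ → ℂ` continuous, nowhere zero and `1`-periodic, `wind (f (· + c)) = wind f`: a global
logarithm `l` of `f` satisfies `l (t + 1) - l t = 2πi · wind f` for all `t`. [folklore] -/
theorem wind_comp_add_of_periodic {f : ℝ → ℂ} (hf : Continuous f) (hne : ∀ t, f t ≠ 0)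
    (hp : Periodic f 1) (c : ℝ) : wind (fun u => f (u + c)) = wind f := by
  obtain ⟨l, hl, hle⟩ := hasLogOn_univ isSimplyConnected_univ_real hf hne
  have hlc : Continuous l := continuousOn_univ.1 hl
  have hle' : ∀ t, exp (l t) = f t := fun t => hle t (mem_univ t)
  -- the two logarithms `l (· + 1)` and `l` of `f` differ by a constant
  obtain ⟨n, hn⟩ := exists_int_eq_add_of_exp_eq isPreconnected_univ (l := fun t => l (t + 1)) (m := l)
    ((hlc.comp (continuous_id.add continuous_const)).continuousOn) hl
    (fun t _ => show exp (l (t + 1)) = exp (l t) by rw [hle', hle', hp t])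
  -- this constant is `2πi · wind f`
  have hw : l 1 - l 0 = wind f * (2 * π * I) :=
    wind_spec hlc.continuousOn (fun t _ => hle' t) (by have := hp 0; rw [zero_add] at this; exact this.symm)
  have hw' : l (1 + c) - l (0 + c) = wind (fun u => f (u + c)) * (2 * π * I) :=
    wind_spec (f := fun u => f (u + c)) (l := fun u => l (u + c))
      ((hlc.comp (continuous_id.add continuous_const)).continuousOn) (fun t _ => hle' (t + c))
      (by have := hp c; rw [zero_add, add_comm]; exact this.symm)
  have h1 : l (c + 1) = l c + n * (2 * π * I) := hn c (mem_univ c)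
  have h0 : l (0 + 1) = l 0 + n * (2 * π * I) := hn 0 (mem_univ 0)
  rw [zero_add] at h0
  apply int_eq_of_mul_two_pi_I_eq
  rw [← hw', ← hw, zero_add, add_comm (1 : ℝ) c, h1, h0]
  ring

/-- **Reversing the parameter negates the winding number.** [folklore] -/
theorem wind_comp_one_sub {f : ℝ → ℂ} (hf : IsNonvanishingLoop f) :
    wind (fun u => f (1 - u)) = -wind f := by
  have hmaps : ∀ t ∈ Icc (0 : ℝ) 1, 1 - t ∈ Icc (0 : ℝ) 1 := fun t ht =>
    ⟨by linarith [ht.2], by linarith [ht.1]⟩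
  have hf' : IsNonvanishingLoop (fun u => f (1 - u)) :=
    ⟨hf.continuousOn.comp (by fun_prop) hmaps, fun t ht => hf.ne_zero _ (hmaps t ht),
      by simp [hf.eq_endpoints]⟩
  have h1 := logInc_eq_wind_mul hf
  have h2 := logInc_eq_wind_mul hf'
  have h3 := logInc_reverse hf.hasLogOn
  apply int_eq_of_mul_two_pi_I_eq
  rw [Int.cast_neg, neg_mul, ← h1, ← h2, h3]

/-! ### The secant map of a curve injective modulo its period -/

/-- Points of the curve at parameters less than a period apart are distinct. [cite: Hopf1935, Satz I] -/
theorem apply_ne_apply_of_sub_mem_Ioo {γ : ℝ → ℂ} {L : ℝ} (hL : 0 < L)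
    (hinj : ∀ ⦃s t : ℝ⦄, γ s = γ t → ∃ m : ℤ, t = s + m * L) {s t : ℝ} (h0 : 0 < t - s)
    (h1 : t - s < L) : γ t ≠ γ s := by
  intro hst
  obtain ⟨m, hm⟩ := hinj hst.symm
  have hm0 : (0 : ℝ) < m := by nlinarith
  have hm1 : (m : ℝ) < 1 := by nlinarith
  have : (0 : ℤ) < m := by exact_mod_cast hm0
  have : m < 1 := by exact_mod_cast hm1
  omega

/-- **The secant map has a continuous logarithm on the strip** `{0 < t - s < L}`: it is
continuous and nowhere zero there (injectivity modulo the period), and the strip is convex and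
open, hence simply connected. [cite: Hopf1935, §2] -/
theorem hasLogOn_secant {γ : ℝ → ℂ} {L : ℝ} (hL : 0 < L) (hγ : Continuous γ)
    (hinj : ∀ ⦃s t : ℝ⦄, γ s = γ t → ∃ m : ℤ, t = s + m * L) :
    HasLogOn (fun p : ℝ × ℝ => γ p.2 - γ p.1) {p : ℝ × ℝ | 0 < p.2 - p.1 ∧ p.2 - p.1 < L} := by
  have hopen : IsOpen {p : ℝ × ℝ | 0 < p.2 - p.1 ∧ p.2 - p.1 < L} := by
    have hc : Continuous fun p : ℝ × ℝ => p.2 - p.1 := by fun_prop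
    exact isOpen_Ioo.preimage hc
  have hconv : Convex ℝ {p : ℝ × ℝ | 0 < p.2 - p.1 ∧ p.2 - p.1 < L} := by
    intro p hp q hq a b ha hb hab
    obtain ⟨hp1, hp2⟩ := hp
    obtain ⟨hq1, hq2⟩ := hq
    simp only [mem_setOf_eq, Prod.snd_add, Prod.fst_add, Prod.smul_snd, Prod.smul_fst, smul_eq_mul]
    have e : a * p.2 + b * q.2 - (a * p.1 + b * q.1) = a * (p.2 - p.1) + b * (q.2 - q.1) := by ring
    rw [e]
    rcases ha.eq_or_lt with rfl | ha'
    · rw [zero_add] at hab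
      rw [hab]
      constructor <;> linarith
    · constructor
      · exact add_pos_of_pos_of_nonneg (mul_pos ha' hp1) (mul_nonneg hb hq1.le)
      · calc a * (p.2 - p.1) + b * (q.2 - q.1) < a * L + b * L :=
              add_lt_add_of_lt_of_le (mul_lt_mul_of_pos_left hp2 ha') (mul_le_mul_of_nonneg_left hq2.le hb)
          _ = L := by rw [← add_mul, hab, one_mul]
  have hne : ({p : ℝ × ℝ | 0 < p.2 - p.1 ∧ p.2 - p.1 < L}).Nonempty :=
    ⟨(0, L / 2), show 0 < L / 2 - 0 ∧ L / 2 - 0 < L from ⟨by linarith, by linarith⟩⟩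
  have hsc : IsSimplyConnected {p : ℝ × ℝ | 0 < p.2 - p.1 ∧ p.2 - p.1 < L} := by
    have := hconv.contractibleSpace hne
    show SimplyConnectedSpace {p : ℝ × ℝ | 0 < p.2 - p.1 ∧ p.2 - p.1 < L}
    infer_instance
  have hSc : Continuous fun p : ℝ × ℝ => γ p.2 - γ p.1 :=
    (hγ.comp continuous_snd).sub (hγ.comp continuous_fst)
  have h0 : (0 : ℂ) ∉ (fun p : ℝ × ℝ => γ p.2 - γ p.1) '' {p : ℝ × ℝ | 0 < p.2 - p.1 ∧ p.2 - p.1 < L} := by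
    rintro ⟨p, hp, hp0⟩
    exact apply_ne_apply_of_sub_mem_Ioo hL hinj hp.1 hp.2 (sub_eq_zero.1 hp0)
  obtain ⟨Λ, hΛ, hΛe⟩ := Complex.exists_continuousOn_eqOn_exp_comp hsc hopen hSc.continuousOn h0
  exact ⟨Λ, hΛ, fun p hp => hΛe hp⟩

/-! ### Periodic `C¹` curves: derivative facts -/

/-- The derivative of a periodic function is periodic. [folklore] -/
theorem periodic_deriv {γ : ℝ → ℂ} {L : ℝ} (hper : Periodic γ L) : Periodic (deriv γ) L := by
  intro t
  have h : (fun x => γ (x + L)) = γ := funext hper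
  rw [← deriv_comp_add_const, h]

/-- The minimum of the speed of a regular periodic `C¹` curve is positive and bounds the speed
from below everywhere. [folklore] -/
theorem exists_pos_le_norm_deriv {γ : ℝ → ℂ} {L : ℝ} (hL : 0 < L) (hγ : ContDiff ℝ 1 γ)
    (hper : Periodic γ L) (hreg : ∀ t, deriv γ t ≠ 0) :
    ∃ m : ℝ, 0 < m ∧ ∀ t, m ≤ ‖deriv γ t‖ := by
  have hc : Continuous (deriv γ) := hγ.continuous_deriv (by simp)
  obtain ⟨t₀, -, hmin⟩ := isCompact_Icc.exists_isMinOn (nonempty_Icc.2 hL.le) hc.norm.continuousOn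
  refine ⟨‖deriv γ t₀‖, norm_pos_iff.2 (hreg t₀), fun t => ?_⟩
  obtain ⟨y, hy, hey⟩ := (periodic_deriv hper).exists_mem_Ico₀ hL t
  rw [hey]
  exact hmin (Ico_subset_Icc_self hy)

/-- **Uniform continuity of the velocity**, in the form used below: for `η > 0` there is
`δ > 0` such that `‖γ' x - γ' y‖ ≤ η` whenever `x, y ∈ [-L, 2L]` and `|x - y| ≤ δ`. [folklore] -/
theorem exists_forall_norm_deriv_sub_le {γ : ℝ → ℂ} (hγ : ContDiff ℝ 1 γ) (L : ℝ) {η : ℝ}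
    (hη : 0 < η) : ∃ δ > 0, ∀ x ∈ Icc (-L) (2 * L), ∀ y ∈ Icc (-L) (2 * L), |x - y| ≤ δ →
      ‖deriv γ x - deriv γ y‖ ≤ η := by
  have hc : Continuous (deriv γ) := hγ.continuous_deriv (by simp)
  have huc := isCompact_Icc.uniformContinuousOn_of_continuous (hc.continuousOn (s := Icc (-L) (2 * L)))
  rw [Metric.uniformContinuousOn_iff] at huc
  obtain ⟨δ, hδ0, h⟩ := huc η hη
  refine ⟨δ / 2, half_pos hδ0, fun x hx y hy hxy => ?_⟩
  have := h x hx y hy (by rw [Real.dist_eq]; linarith)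
  rw [dist_eq_norm] at this
  exact this.le

/-! ### The normalised Umlaufsatz -/
set_option maxHeartbeats 400000 in -- buildfix (bf3-g26): 160k/180k FAIL, 200k PASS at accept time; line-neutral budget line
/-- **Hopf's Umlaufsatz, normalised** (Hartman, *ODE*, Thm. VII.2.1, proof): let `γ` be an
`L`-periodic plane curve of class `C¹` with nowhere-vanishing derivative, injective modulo the
period, such that `γ 0` is a lowest point of the curve (`Im γ 0 ≤ Im γ t`) and `γ' 0` points in
the positive real direction. Then the velocity loop `u ↦ γ' (L u)` winds exactly once, positively,
about the origin. See the module docstring for the secant argument. [cite: Hartman2002, Ch. VII Thm. 2.1] -/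
theorem wind_deriv_eq_one_of_lowest {γ : ℝ → ℂ} {L : ℝ} (hL : 0 < L) (hγ : ContDiff ℝ 1 γ)
    (hper : Periodic γ L) (hinj : ∀ ⦃s t : ℝ⦄, γ s = γ t → ∃ m : ℤ, t = s + m * L)
    (hreg : ∀ t, deriv γ t ≠ 0) (hlow : ∀ t, (γ 0).im ≤ (γ t).im) (hdir : 0 < (deriv γ 0).re) :
    wind (fun u => deriv γ (L * u)) = 1 := by
  /- ## Step 0: derivative facts, the constants `v`, `m`, `η`, `δ`, `ε` -/
  have hγc : Continuous γ := hγ.continuous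
  have hdiff : Differentiable ℝ γ := hγ.differentiable (by simp)
  have hd : ∀ t, HasDerivAt γ (deriv γ t) t := fun t => (hdiff t).hasDerivAt
  have hγ'c : Continuous (deriv γ) := hγ.continuous_deriv (by simp)
  have hper' : Periodic (deriv γ) L := periodic_deriv hper
  -- `γ' 0 = v > 0` is real (Fermat at the lowest point)
  have him0 : (deriv γ 0).im = 0 := by
    have h1 : HasDerivAt (fun t => (γ t).im) (deriv γ 0).im 0 :=
      Complex.imCLM.hasFDerivAt.comp_hasDerivAt (0 : ℝ) (hd 0)
    have hmin : IsLocalMin (fun t => (γ t).im) 0 := Filter.Eventually.of_forall fun t => hlow t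
    rw [← h1.deriv]
    exact hmin.deriv_eq_zero
  set v : ℝ := (deriv γ 0).re with hv_def
  have hv : deriv γ 0 = (v : ℂ) := Complex.ext (by simp [hv_def]) (by simp [him0])
  have hv0 : 0 < v := hdir
  -- the minimal speed `m`
  obtain ⟨m, hm0, hm⟩ := exists_pos_le_norm_deriv hL hγ hper hreg
  have hmv : m ≤ v := by
    have := hm 0
    rwa [hv, norm_real, Real.norm_of_nonneg hv0.le] at this
  -- uniform continuity: `η = m/4`, `δ`
  obtain ⟨δ, hδ0, hδ⟩ := exists_forall_norm_deriv_sub_le hγ L (η := m / 4) (by linarith)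
  -- the offset `ε`
  set ε : ℝ := min δ (L / 4) with hε_def
  have hε0 : 0 < ε := lt_min hδ0 (by linarith)
  have hεδ : ε ≤ δ := min_le_left _ _
  have hεL : 4 * ε ≤ L := by have := min_le_right δ (L / 4); rw [← hε_def] at this; linarith
  have hε2 : 0 < L - 2 * ε := by linarith
  have hε' : (ε : ℂ) ≠ 0 := by exact_mod_cast hε0.ne'
  have hv' : (v : ℂ) ≠ 0 := by exact_mod_cast hv0.ne'
  have hεv : ((ε : ℂ) * v) ≠ 0 := mul_ne_zero hε' hv'
  /- ## Step 1: the two mean value estimates -/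
  -- (E1) short secants ending in `[0, ε]`, against the velocity `v = γ' 0`
  have hζB : ∀ x ∈ Icc (0 : ℝ) ε, ‖(γ x - γ (x - ε)) / ((ε : ℂ) * v) - 1‖ ≤ 1 / 4 := by
    intro x hx
    have hMVT := norm_sub_sub_mul_le hd (show x - ε ≤ x by linarith) (w := (v : ℂ)) (η := m / 4)
      (fun t ht => by
        rw [← hv]
        refine hδ t ⟨by linarith [ht.1, hx.1], by linarith [ht.2, hx.2]⟩ 0 ⟨by linarith, by linarith⟩ ?_
        rw [sub_zero, abs_le]; exact ⟨by linarith [ht.1, hx.1], by linarith [ht.2, hx.2]⟩)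
    rw [show x - (x - ε) = ε by ring] at hMVT
    refine norm_div_sub_one_le hεv ?_
    rw [norm_mul, norm_real, norm_real, Real.norm_of_nonneg hε0.le, Real.norm_of_nonneg hv0.le]
    calc ‖γ x - γ (x - ε) - (ε : ℂ) * v‖ ≤ m / 4 * ε := hMVT
      _ ≤ ε * v / 4 := by nlinarith
  -- (E2) secants of span `ε` starting in `[0, L]`, against the velocity at the start
  have hρ : ∀ s ∈ Icc (0 : ℝ) L, ‖(γ (s + ε) - γ s) / ((ε : ℂ) * deriv γ s) - 1‖ ≤ 1 / 4 := by
    intro s hs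
    have hMVT := norm_sub_sub_mul_le hd (show s ≤ s + ε by linarith) (w := deriv γ s) (η := m / 4)
      (fun t ht => hδ t ⟨by linarith [ht.1, hs.1], by linarith [ht.2, hs.2]⟩ s
        ⟨by linarith [hs.1], by linarith [hs.2]⟩ (by rw [abs_le]; exact ⟨by linarith [ht.1], by linarith [ht.2]⟩))
    rw [show s + ε - s = ε by ring] at hMVT
    have hγs : deriv γ s ≠ 0 := hreg s
    refine norm_div_sub_one_le (mul_ne_zero (by exact_mod_cast hε0.ne') hγs) ?_
    rw [norm_mul, norm_real, Real.norm_of_nonneg hε0.le]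
    calc ‖γ (s + ε) - γ s - (ε : ℂ) * deriv γ s‖ ≤ m / 4 * ε := hMVT
      _ ≤ ε * ‖deriv γ s‖ / 4 := by nlinarith [hm s]
  /- ## Step 2: the secant map, its logarithm on the strip, and the closed chain -/
  obtain ⟨Λ, hΛ, hΛe⟩ := hasLogOn_secant hL hγc hinj
  -- the four pieces of the chain
  have mA : MapsTo (fun u : ℝ => ((0 : ℝ), ε + u * (L - 2 * ε))) (Icc 0 1)
      {p : ℝ × ℝ | 0 < p.2 - p.1 ∧ p.2 - p.1 < L} := fun u hu =>
    ⟨by simp only [sub_zero]; nlinarith [hu.1], by simp only [sub_zero]; nlinarith [hu.2]⟩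
  have mB : MapsTo (fun u : ℝ => (u * ε, L - ε + u * ε)) (Icc 0 1)
      {p : ℝ × ℝ | 0 < p.2 - p.1 ∧ p.2 - p.1 < L} := fun u _ =>
    ⟨by show 0 < L - ε + u * ε - u * ε; linarith, by show L - ε + u * ε - u * ε < L; linarith⟩
  have mC : MapsTo (fun u : ℝ => (ε + u * (L - 2 * ε), L)) (Icc 0 1)
      {p : ℝ × ℝ | 0 < p.2 - p.1 ∧ p.2 - p.1 < L} := fun u hu =>
    ⟨by show 0 < L - (ε + u * (L - 2 * ε)); nlinarith [hu.2],
      by show L - (ε + u * (L - 2 * ε)) < L; nlinarith [hu.1]⟩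
  have mD : MapsTo (fun u : ℝ => ((L - ε) * (1 - u), (L - ε) * (1 - u) + ε)) (Icc 0 1)
      {p : ℝ × ℝ | 0 < p.2 - p.1 ∧ p.2 - p.1 < L} := fun u _ =>
    ⟨by show 0 < (L - ε) * (1 - u) + ε - (L - ε) * (1 - u); linarith,
      by show (L - ε) * (1 - u) + ε - (L - ε) * (1 - u) < L; linarith⟩
  have eA := logInc_comp_of_log hΛ hΛe (γ := fun u : ℝ => ((0 : ℝ), ε + u * (L - 2 * ε)))
    (by fun_prop) mA
  have eB := logInc_comp_of_log hΛ hΛe (γ := fun u : ℝ => (u * ε, L - ε + u * ε)) (by fun_prop) mB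
  have eC := logInc_comp_of_log hΛ hΛe (γ := fun u : ℝ => (ε + u * (L - 2 * ε), L)) (by fun_prop) mC
  have eD := logInc_comp_of_log hΛ hΛe (γ := fun u : ℝ => ((L - ε) * (1 - u), (L - ε) * (1 - u) + ε))
    (by fun_prop) mD
  have chain : logInc ((fun p : ℝ × ℝ => γ p.2 - γ p.1) ∘ fun u : ℝ => ((0 : ℝ), ε + u * (L - 2 * ε))) +
      logInc ((fun p : ℝ × ℝ => γ p.2 - γ p.1) ∘ fun u : ℝ => (u * ε, L - ε + u * ε)) +
      logInc ((fun p : ℝ × ℝ => γ p.2 - γ p.1) ∘ fun u : ℝ => (ε + u * (L - 2 * ε), L)) +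
      logInc ((fun p : ℝ × ℝ => γ p.2 - γ p.1) ∘ fun u : ℝ => ((L - ε) * (1 - u), (L - ε) * (1 - u) + ε))
        = 0 := by
    rw [eA, eB, eC, eD]
    have e1 : ((0 : ℝ), ε + 1 * (L - 2 * ε)) = ((0 : ℝ) * ε, L - ε + 0 * ε) := by
      rw [Prod.mk.injEq]; exact ⟨by ring, by ring⟩
    have e2 : ((1 : ℝ) * ε, L - ε + 1 * ε) = (ε + 0 * (L - 2 * ε), L) := by
      rw [Prod.mk.injEq]; exact ⟨by ring, by ring⟩
    have e3 : (ε + 1 * (L - 2 * ε), L) = ((L - ε) * (1 - 0), (L - ε) * (1 - 0) + ε) := by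
      rw [Prod.mk.injEq]; exact ⟨by ring, by ring⟩
    have e4 : ((L - ε) * (1 - 1), (L - ε) * (1 - 1) + ε) = ((0 : ℝ), ε + 0 * (L - 2 * ε)) := by
      rw [Prod.mk.injEq]; exact ⟨by ring, by ring⟩
    rw [e1, e2, e3, e4]; ring
  /- ## Step 3: leg A and leg C -/
  have hA_mem : ∀ u ∈ Icc (0 : ℝ) 1, -I * (γ (ε + u * (L - 2 * ε)) - γ 0) ∈ slitPlane := by
    intro u hu
    have hne : γ (ε + u * (L - 2 * ε)) ≠ γ 0 :=
      apply_ne_apply_of_sub_mem_Ioo hL hinj (by rw [sub_zero]; nlinarith [hu.1])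
        (by rw [sub_zero]; nlinarith [hu.2])
    rw [mem_slitPlane_iff]
    have hre : (-I * (γ (ε + u * (L - 2 * ε)) - γ 0)).re = (γ (ε + u * (L - 2 * ε))).im - (γ 0).im := by
      simp
    have him : (-I * (γ (ε + u * (L - 2 * ε)) - γ 0)).im =
        -((γ (ε + u * (L - 2 * ε))).re - (γ 0).re) := by simp
    rw [hre, him]
    rcases (sub_nonneg.2 (hlow (ε + u * (L - 2 * ε)))).lt_or_eq with hlt | heq
    · exact Or.inl hlt
    · right
      intro h0
      apply hne
      apply Complex.ext <;> linarith
  have hGAc : ContinuousOn (fun u : ℝ => -I * (γ (ε + u * (L - 2 * ε)) - γ 0)) (Icc 0 1) := by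
    have := hγc
    fun_prop
  have hA_log : HasLogOn (fun u : ℝ => -I * (γ (ε + u * (L - 2 * ε)) - γ 0)) (Icc 0 1) :=
    hasLogOn_of_mem_slitPlane hGAc hA_mem
  have hSA : ((fun p : ℝ × ℝ => γ p.2 - γ p.1) ∘ fun u : ℝ => ((0 : ℝ), ε + u * (L - 2 * ε))) =
      fun u => I * (-I * (γ (ε + u * (L - 2 * ε)) - γ 0)) := by
    funext u
    simp only [comp_apply]
    rw [← mul_assoc, mul_neg, I_mul_I, neg_neg, one_mul]
  have hSA_log : HasLogOn ((fun p : ℝ × ℝ => γ p.2 - γ p.1) ∘ fun u : ℝ => ((0 : ℝ), ε + u * (L - 2 * ε)))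
      (Icc 0 1) := by
    rw [hSA]; exact (hasLogOn_const I_ne_zero _).mul hA_log
  have eA_val : logInc ((fun p : ℝ × ℝ => γ p.2 - γ p.1) ∘ fun u : ℝ => ((0 : ℝ), ε + u * (L - 2 * ε))) =
      log (-I * (γ (L - ε) - γ 0)) - log (-I * (γ ε - γ 0)) := by
    rw [hSA, logInc_const_mul hA_log I_ne_zero, logInc_eq_log_sub_log hGAc hA_mem]
    simp only [one_mul, zero_mul, add_zero]
    rw [show ε + (L - 2 * ε) = L - ε by ring]
  have hSC : ((fun p : ℝ × ℝ => γ p.2 - γ p.1) ∘ fun u : ℝ => (ε + u * (L - 2 * ε), L)) =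
      fun u => (-1 : ℂ) * ((fun p : ℝ × ℝ => γ p.2 - γ p.1) ∘ fun u : ℝ => ((0 : ℝ), ε + u * (L - 2 * ε))) u := by
    funext u
    have hL0 : γ L = γ 0 := by have := hper 0; rwa [zero_add] at this
    simp only [comp_apply, hL0]
    ring
  have eC_val : logInc ((fun p : ℝ × ℝ => γ p.2 - γ p.1) ∘ fun u : ℝ => (ε + u * (L - 2 * ε), L)) =
      logInc ((fun p : ℝ × ℝ => γ p.2 - γ p.1) ∘ fun u : ℝ => ((0 : ℝ), ε + u * (L - 2 * ε))) := by
    rw [hSC, logInc_const_mul hSA_log (by norm_num)]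
  /- ## Step 4: side B -/
  have hζB_cont : ContinuousOn (fun u : ℝ => (γ (u * ε) - γ (u * ε - ε)) / ((ε : ℂ) * v)) (Icc 0 1) := by
    have := hγc
    fun_prop
  have hζB_mem : ∀ u ∈ Icc (0 : ℝ) 1, (γ (u * ε) - γ (u * ε - ε)) / ((ε : ℂ) * v) ∈ slitPlane :=
    fun u hu => mem_slitPlane_of_norm_sub_one_le (hζB (u * ε) ⟨by nlinarith [hu.1], by nlinarith [hu.2]⟩)
  have hSB : ((fun p : ℝ × ℝ => γ p.2 - γ p.1) ∘ fun u : ℝ => (u * ε, L - ε + u * ε)) =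
      fun u => (-((ε : ℂ) * v)) * ((γ (u * ε) - γ (u * ε - ε)) / ((ε : ℂ) * v)) := by
    funext u
    simp only [comp_apply]
    rw [show L - ε + u * ε = (u * ε - ε) + L by ring, hper]
    field_simp
    ring
  have eB_val : logInc ((fun p : ℝ × ℝ => γ p.2 - γ p.1) ∘ fun u : ℝ => (u * ε, L - ε + u * ε)) =
      log ((γ ε - γ (ε - ε)) / ((ε : ℂ) * v)) - log ((γ 0 - γ (0 - ε)) / ((ε : ℂ) * v)) := by
    rw [hSB, logInc_const_mul (hasLogOn_of_mem_slitPlane hζB_cont hζB_mem) (neg_ne_zero.2 hεv),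
      logInc_eq_log_sub_log hζB_cont hζB_mem]
    simp only [one_mul, zero_mul]
  /- ## Step 5: the diagonal side D -/
  -- a global logarithm of the velocity, and the winding number through it
  obtain ⟨l, hl, hle⟩ := hasLogOn_univ isSimplyConnected_univ_real hγ'c hreg
  have hlc : Continuous l := continuousOn_univ.1 hl
  have hle' : ∀ t, exp (l t) = deriv γ t := fun t => hle t (mem_univ t)
  have hw : l L - l 0 = wind (fun u => deriv γ (L * u)) * (2 * π * I) := by
    have := wind_spec (f := fun u => deriv γ (L * u)) (l := fun u => l (L * u))
      ((hlc.comp (continuous_const.mul continuous_id)).continuousOn) (fun t _ => hle' _)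
      (by simp only [mul_zero, mul_one]; have := hper' 0; rw [zero_add] at this; exact this.symm)
    simpa using this
  -- the ratio `(γ (s+ε) - γ s) / γ' s = ε ρ(s)` lies in the right half-plane for `s ∈ [0, L]`
  have hρ_eq : ∀ s, (γ (s + ε) - γ s) / deriv γ s = (ε : ℂ) * ((γ (s + ε) - γ s) / ((ε : ℂ) * deriv γ s)) := by
    intro s
    have := hreg s
    have hε' : (ε : ℂ) ≠ 0 := by exact_mod_cast hε0.ne'
    field_simp
  have hρ_mem : ∀ s ∈ Icc (0 : ℝ) L, (γ (s + ε) - γ s) / deriv γ s ∈ slitPlane := by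
    intro s hs
    rw [hρ_eq s]
    left
    rw [re_ofReal_mul]
    exact mul_pos hε0 (by linarith [(re_im_bounds_of_norm_sub_one_le (hρ s hs)).1])
  have hmapsD : ∀ u ∈ Icc (0 : ℝ) 1, (L - ε) * u ∈ Icc (0 : ℝ) L := fun u hu =>
    ⟨by nlinarith [hu.1], by nlinarith [hu.2]⟩
  -- the logarithm `λ` of the forward diagonal secant `d u = γ ((L-ε)u + ε) - γ ((L-ε)u)`
  have hlam_c : ContinuousOn (fun u : ℝ => l ((L - ε) * u) +
      log ((γ ((L - ε) * u + ε) - γ ((L - ε) * u)) / deriv γ ((L - ε) * u))) (Icc 0 1) := by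
    refine ((hlc.comp (continuous_const.mul continuous_id)).continuousOn).add ?_
    refine ContinuousOn.clog ?_ fun u hu => hρ_mem _ (hmapsD u hu)
    have := hγc
    have := hγ'c
    exact ContinuousOn.div (by fun_prop) (by fun_prop) fun u _ => hreg _
  have hlam_e : ∀ u ∈ Icc (0 : ℝ) 1, exp (l ((L - ε) * u) +
      log ((γ ((L - ε) * u + ε) - γ ((L - ε) * u)) / deriv γ ((L - ε) * u))) =
        γ ((L - ε) * u + ε) - γ ((L - ε) * u) := by
    intro u hu
    rw [exp_add, hle', exp_log (slitPlane_ne_zero (hρ_mem _ (hmapsD u hu))), mul_div_cancel₀ _ (hreg _)]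
  have hd_log : HasLogOn (fun u : ℝ => γ ((L - ε) * u + ε) - γ ((L - ε) * u)) (Icc 0 1) :=
    ⟨_, hlam_c, hlam_e⟩
  have hSD : ((fun p : ℝ × ℝ => γ p.2 - γ p.1) ∘ fun u : ℝ => ((L - ε) * (1 - u), (L - ε) * (1 - u) + ε)) =
      fun u => (fun u : ℝ => γ ((L - ε) * u + ε) - γ ((L - ε) * u)) (1 - u) := rfl
  have eD_val : logInc ((fun p : ℝ × ℝ => γ p.2 - γ p.1) ∘ fun u : ℝ => ((L - ε) * (1 - u), (L - ε) * (1 - u) + ε)) =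
      -((l (L - ε) + log ((γ (L - ε + ε) - γ (L - ε)) / deriv γ (L - ε))) -
        (l 0 + log ((γ (0 + ε) - γ 0) / deriv γ 0))) := by
    rw [hSD, logInc_reverse hd_log, logInc_eq hlam_c hlam_e]
    simp only [mul_one, mul_zero]
  -- `l (L - ε) - l L = log (γ' (L-ε) / γ' L)`
  have hφ : ∀ x ∈ Icc (L - ε) L, ‖deriv γ x / deriv γ L - 1‖ ≤ 1 / 4 := by
    intro x hx
    refine norm_div_sub_one_le (hreg L) ?_
    have h1 := hδ x ⟨by linarith [hx.1], by linarith [hx.2]⟩ L ⟨by linarith, by linarith⟩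
      (by rw [abs_le]; exact ⟨by linarith [hx.1], by linarith [hx.2]⟩)
    linarith [hm L]
  have hφ_mem : ∀ x ∈ Icc (L - ε) L, deriv γ x / deriv γ L ∈ slitPlane := fun x hx =>
    mem_slitPlane_of_norm_sub_one_le (hφ x hx)
  obtain ⟨n, hn⟩ := exists_int_eq_add_of_exp_eq isPreconnected_Icc (l := fun x => l x - l L)
    (m := fun x => log (deriv γ x / deriv γ L)) ((hlc.sub continuous_const).continuousOn)
    (ContinuousOn.clog (hγ'c.continuousOn.div continuousOn_const fun _ _ => hreg L) hφ_mem)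
    (fun x hx => by
      rw [exp_sub, hle', hle', exp_log (slitPlane_ne_zero (hφ_mem x hx))])
  have hn0 : n = 0 := by
    have := hn L ⟨by linarith, le_rfl⟩
    rw [sub_self, div_self (hreg L), log_one, zero_add] at this
    have h2 : ((n : ℤ) : ℂ) * (2 * π * I) = ((0 : ℤ) : ℂ) * (2 * π * I) := by rw [← this]; simp
    exact int_eq_of_mul_two_pi_I_eq h2
  have hlLε : l (L - ε) - l L = log (deriv γ (L - ε) / deriv γ L) := by
    have := hn (L - ε) ⟨le_rfl, by linarith⟩
    rw [hn0] at this
    simpa using this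
  /- ## Step 6: imaginary parts and the final count -/
  -- rewrite the chain identity with the values of the four increments
  rw [eC_val, eA_val, eB_val, eD_val] at chain
  -- tidy the arguments appearing
  have e1 : -I * (γ (L - ε) - γ 0) = ((ε * v : ℝ) : ℂ) * (I * ((γ 0 - γ (0 - ε)) / ((ε : ℂ) * v))) := by
    rw [show L - ε = -ε + L by ring, hper, zero_sub]
    push_cast
    field_simp
    ring
  have e2 : -I * (γ ε - γ 0) = ((ε * v : ℝ) : ℂ) * (-I * ((γ ε - γ (ε - ε)) / ((ε : ℂ) * v))) := by
    rw [sub_self]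
    push_cast
    field_simp
  have e3 : l (L - ε) = log (deriv γ (L - ε) / deriv γ L) + l 0 + wind (fun u => deriv γ (L * u)) * (2 * π * I) := by
    rw [← hlLε, ← hw]; ring
  have e4 : (γ (L - ε + ε) - γ (L - ε)) / deriv γ (L - ε) =
      (ε : ℂ) * ((γ (L - ε + ε) - γ (L - ε)) / ((ε : ℂ) * deriv γ (L - ε))) := hρ_eq (L - ε)
  have e5 : (γ (0 + ε) - γ 0) / deriv γ 0 = (ε : ℂ) * ((γ (0 + ε) - γ 0) / ((ε : ℂ) * deriv γ 0)) := hρ_eq 0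
  rw [e1, e2, e3, e4, e5] at chain
  have hεv_pos : 0 < ε * v := mul_pos hε0 hv0
  -- the imaginary parts of the logarithms involved
  have i1 : (log (((ε * v : ℝ) : ℂ) * (I * ((γ 0 - γ (0 - ε)) / ((ε : ℂ) * v))))).im =
      arg (I * ((γ 0 - γ (0 - ε)) / ((ε : ℂ) * v))) := by rw [log_im, arg_real_mul _ hεv_pos]
  have i2 : (log (((ε * v : ℝ) : ℂ) * (-I * ((γ ε - γ (ε - ε)) / ((ε : ℂ) * v))))).im =
      arg (-I * ((γ ε - γ (ε - ε)) / ((ε : ℂ) * v))) := by rw [log_im, arg_real_mul _ hεv_pos]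
  have i3 : (log ((ε : ℂ) * ((γ (L - ε + ε) - γ (L - ε)) / ((ε : ℂ) * deriv γ (L - ε))))).im =
      arg ((γ (L - ε + ε) - γ (L - ε)) / ((ε : ℂ) * deriv γ (L - ε))) := by
    rw [log_im, arg_real_mul _ hε0]
  have i4 : (log ((ε : ℂ) * ((γ (0 + ε) - γ 0) / ((ε : ℂ) * deriv γ 0)))).im =
      arg ((γ (0 + ε) - γ 0) / ((ε : ℂ) * deriv γ 0)) := by rw [log_im, arg_real_mul _ hε0]
  have iw : ((wind (fun u => deriv γ (L * u)) : ℂ) * (2 * π * I)).im =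
      2 * π * (wind (fun u => deriv γ (L * u)) : ℝ) := by
    rw [show ((wind (fun u => deriv γ (L * u)) : ℂ) * (2 * π * I)) =
      ((2 * π * (wind (fun u => deriv γ (L * u)) : ℝ) : ℝ) : ℂ) * I by push_cast; ring, mul_I_im, ofReal_re]
  have him := congrArg Complex.im chain
  simp only [add_im, sub_im, neg_im, zero_im, log_im] at him
  rw [log_im] at i1 i2 i3 i4
  rw [i1, i2, i3, i4, iw] at him
  -- the bounds
  have hA1 := arg_I_mul_mem_Icc (hζB 0 ⟨le_rfl, hε0.le⟩)
  have hA0 := arg_neg_I_mul_mem_Icc (hζB ε ⟨hε0.le, le_rfl⟩)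
  have hBε := abs_le.1 (abs_arg_le_of_norm_sub_one_le (hζB ε ⟨hε0.le, le_rfl⟩))
  have hB0 := abs_le.1 (abs_arg_le_of_norm_sub_one_le (hζB 0 ⟨le_rfl, hε0.le⟩))
  have hF := abs_le.1 (abs_arg_le_of_norm_sub_one_le (hφ (L - ε) ⟨le_rfl, by linarith⟩))
  have hR1 := abs_le.1 (abs_arg_le_of_norm_sub_one_le (hρ (L - ε) ⟨by linarith, by linarith⟩))
  have hR0 := abs_le.1 (abs_arg_le_of_norm_sub_one_le (hρ 0 ⟨le_rfl, hL.le⟩))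
  have hπ := Real.pi_pos
  -- conclusion: `π/2 ≤ 2π w ≤ 7π/2`
  have hlo : π / 2 ≤ 2 * π * (wind (fun u => deriv γ (L * u)) : ℝ) := by
    linarith [hA1.1, hA1.2, hA0.1, hA0.2]
  have hhi : 2 * π * (wind (fun u => deriv γ (L * u)) : ℝ) ≤ 7 * π / 2 := by
    linarith [hA1.1, hA1.2, hA0.1, hA0.2]
  have hW0 : (0 : ℝ) < (wind (fun u => deriv γ (L * u)) : ℝ) := by
    by_contra hcon
    push Not at hcon
    nlinarith
  have hW2 : (wind (fun u => deriv γ (L * u)) : ℝ) < 2 := by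
    by_contra hcon
    push Not at hcon
    nlinarith
  have h0 : (0 : ℤ) < wind (fun u => deriv γ (L * u)) := by exact_mod_cast hW0
  have h2 : wind (fun u => deriv γ (L * u)) < 2 := by exact_mod_cast hW2
  omega

/-! ### The Umlaufsatz -/

/-- **Hopf's Umlaufsatz** (H. Hopf, Compositio Math. 2 (1935), Satz I; Hartman, *ODE*,
Thm. VII.2.1): for an `L`-periodic plane curve `γ` of class `C¹` with nowhere-vanishing
derivative which is injective modulo the period, the velocity loop `u ↦ γ' (L u)`, `u ∈ [0, 1]`,
has winding number `1` or `-1` about the origin — the tangent turns exactly once. Proof: move the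
origin of the parameter to a lowest point of the curve (`wind_comp_add_of_periodic`), where the
velocity is horizontal; if it points to the right apply `wind_deriv_eq_one_of_lowest`, otherwise
apply it to the reversed curve (`wind_comp_one_sub`). [cite: Hopf1935, Satz I] -/
theorem wind_deriv_eq_one_or_eq_neg_one {γ : ℝ → ℂ} {L : ℝ} (hL : 0 < L) (hγ : ContDiff ℝ 1 γ)
    (hper : Periodic γ L) (hinj : ∀ ⦃s t : ℝ⦄, γ s = γ t → ∃ m : ℤ, t = s + m * L)
    (hreg : ∀ t, deriv γ t ≠ 0) :
    wind (fun u => deriv γ (L * u)) = 1 ∨ wind (fun u => deriv γ (L * u)) = -1 := by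
  have hγc : Continuous γ := hγ.continuous
  have hγ'c : Continuous (deriv γ) := hγ.continuous_deriv (by simp)
  have hper' : Periodic (deriv γ) L := periodic_deriv hper
  have hL0 : L ≠ 0 := hL.ne'
  -- a lowest point `s₀`
  obtain ⟨s₀, -, hmin⟩ := isCompact_Icc.exists_isMinOn (nonempty_Icc.2 hL.le)
    (continuous_im.comp hγc).continuousOn
  have hlow : ∀ t, (γ s₀).im ≤ (γ t).im := fun t => by
    obtain ⟨y, hy, hey⟩ := hper.exists_mem_Ico₀ hL t
    have := hmin (Ico_subset_Icc_self hy)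
    simp only [comp_apply] at this
    rw [hey]
    exact this
  -- the velocity loop `f` and its `1`-periodicity
  have hfc : Continuous fun u : ℝ => deriv γ (L * u) := hγ'c.comp (continuous_const.mul continuous_id)
  have hfne : ∀ u : ℝ, deriv γ (L * u) ≠ 0 := fun u => hreg _
  have hfp : Periodic (fun u : ℝ => deriv γ (L * u)) 1 := fun u => by
    show deriv γ (L * (u + 1)) = deriv γ (L * u)
    rw [mul_add, mul_one]
    exact hper' _
  -- the shifted curve `γ₁ = γ (· + s₀)`
  have hγ₁ : ContDiff ℝ 1 (fun t => γ (t + s₀)) := hγ.comp (contDiff_id.add contDiff_const)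
  have hper₁ : Periodic (fun t => γ (t + s₀)) L := fun t => by
    show γ (t + L + s₀) = γ (t + s₀)
    rw [add_right_comm]
    exact hper _
  have hinj₁ : ∀ ⦃s t : ℝ⦄, (fun t => γ (t + s₀)) s = (fun t => γ (t + s₀)) t → ∃ m : ℤ, t = s + m * L :=
    fun s t h => by
      obtain ⟨m, hm⟩ := hinj h
      exact ⟨m, by linarith⟩
  have hder₁ : ∀ t, deriv (fun t => γ (t + s₀)) t = deriv γ (t + s₀) := fun t => deriv_comp_add_const _ _ _
  have hreg₁ : ∀ t, deriv (fun t => γ (t + s₀)) t ≠ 0 := fun t => by rw [hder₁]; exact hreg _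
  have hlow₁ : ∀ t, ((fun t => γ (t + s₀)) 0).im ≤ ((fun t => γ (t + s₀)) t).im := fun t => by
    simp only [zero_add]; exact hlow _
  have hper₁' : Periodic (deriv (fun t => γ (t + s₀))) L := periodic_deriv hper₁
  -- its velocity loop is a translate of `f`
  have hloop₁ : (fun u => deriv (fun t => γ (t + s₀)) (L * u)) = fun u => deriv γ (L * (u + s₀ / L)) := by
    funext u
    rw [hder₁, mul_add, mul_div_cancel₀ _ hL0]
  have hw₁ : wind (fun u => deriv (fun t => γ (t + s₀)) (L * u)) = wind (fun u => deriv γ (L * u)) := by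
    rw [hloop₁]
    exact wind_comp_add_of_periodic hfc hfne hfp (s₀ / L)
  -- the velocity at the lowest point is horizontal
  have him : (deriv (fun t => γ (t + s₀)) 0).im = 0 := by
    have h1 : HasDerivAt (fun t => (γ (t + s₀)).im) (deriv (fun t => γ (t + s₀)) 0).im 0 :=
      Complex.imCLM.hasFDerivAt.comp_hasDerivAt (0 : ℝ) ((hγ₁.differentiable (by simp)) 0).hasDerivAt
    have hmin₁ : IsLocalMin (fun t => (γ (t + s₀)).im) 0 :=
      Filter.Eventually.of_forall fun t => by have := hlow₁ t; simpa using this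
    rw [← h1.deriv]
    exact hmin₁.deriv_eq_zero
  have hre : (deriv (fun t => γ (t + s₀)) 0).re ≠ 0 := fun h =>
    hreg₁ 0 (Complex.ext (by rw [h, zero_re]) (by rw [him, zero_im]))
  rcases lt_or_gt_of_ne hre with hneg | hpos
  · -- reverse the orientation: `γ₂ = γ₁ (-·)`
    right
    have hγ₂ : ContDiff ℝ 1 (fun t => γ (-t + s₀)) := hγ.comp (contDiff_neg.add contDiff_const)
    have hper₂ : Periodic (fun t => γ (-t + s₀)) L := fun t => by
      show γ (-(t + L) + s₀) = γ (-t + s₀)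
      rw [show -(t + L) + s₀ = (-t + s₀) - L by ring, hper.sub_eq]
    have hinj₂ : ∀ ⦃s t : ℝ⦄, (fun t => γ (-t + s₀)) s = (fun t => γ (-t + s₀)) t →
        ∃ m : ℤ, t = s + m * L := fun s t h => by
      obtain ⟨m, hm⟩ := hinj h
      exact ⟨-m, by push_cast; linarith⟩
    have hder₂ : ∀ t, deriv (fun t => γ (-t + s₀)) t = -deriv γ (-t + s₀) := fun t => by
      have h := deriv_comp_neg (fun x => γ (x + s₀)) t
      rw [hder₁] at h
      exact h
    have hreg₂ : ∀ t, deriv (fun t => γ (-t + s₀)) t ≠ 0 := fun t => by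
      rw [hder₂]; exact neg_ne_zero.2 (hreg _)
    have hlow₂ : ∀ t, ((fun t => γ (-t + s₀)) 0).im ≤ ((fun t => γ (-t + s₀)) t).im := fun t => by
      simp only [neg_zero, zero_add]; exact hlow _
    have hdir₂ : 0 < (deriv (fun t => γ (-t + s₀)) 0).re := by
      rw [hder₂, neg_zero, neg_re, ← hder₁]
      linarith
    have h2 := wind_deriv_eq_one_of_lowest hL hγ₂ hper₂ hinj₂ hreg₂ hlow₂ hdir₂
    -- the velocity loop of `γ₂` is minus the reversed velocity loop of `γ₁`
    have hloop₂ : (fun u => deriv (fun t => γ (-t + s₀)) (L * u)) =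
        fun u => (-1 : ℂ) * (fun u => deriv (fun t => γ (t + s₀)) (L * u)) (1 - u) := by
      funext u
      show deriv (fun t => γ (-t + s₀)) (L * u) = -1 * deriv (fun t => γ (t + s₀)) (L * (1 - u))
      rw [hder₂, hder₁, show -(L * u) + s₀ = (L * (1 - u) + s₀) - L by ring, hper'.sub_eq]
      ring
    have hnv : IsNonvanishingLoop fun u => deriv (fun t => γ (t + s₀)) (L * u) := by
      refine ⟨?_, fun u _ => hreg₁ _, ?_⟩
      · have : Continuous fun u => deriv (fun t => γ (t + s₀)) (L * u) := by
          simp only [hder₁]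
          exact hγ'c.comp ((continuous_const.mul continuous_id).add continuous_const)
        exact this.continuousOn
      · simp only [mul_zero, mul_one]
        have := hper₁' 0
        rw [zero_add] at this
        exact this.symm
    have hnv' : IsNonvanishingLoop fun u => (fun u => deriv (fun t => γ (t + s₀)) (L * u)) (1 - u) :=
      ⟨hnv.continuousOn.comp (by fun_prop) fun t ht => ⟨by linarith [ht.2], by linarith [ht.1]⟩,
        fun t ht => hnv.ne_zero _ ⟨by linarith [ht.2], by linarith [ht.1]⟩, by
          have := hnv.eq_endpoints
          simp only [mul_zero, mul_one] at this
          simp only [sub_zero, sub_self, mul_one, mul_zero]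
          exact this.symm⟩
    rw [hloop₂, wind_mul (IsNonvanishingLoop.const (by norm_num)) hnv', wind_const, zero_add,
      wind_comp_one_sub hnv, hw₁] at h2
    omega
  · left
    rw [← hw₁]
    exact wind_deriv_eq_one_of_lowest hL hγ₁ hper₁ hinj₁ hreg₁ hlow₁ hpos

/-! ### Fields along the curve that are never opposite to the tangent -/

/-- **Deformation lemma** (Hartman, *ODE*, Lemma VII.2.1, straight-line case): a continuous
`L`-periodic field `V` along the curve whose ratio to the velocity avoids the cut `(-∞, 0]`
(the field is nowhere zero and never points opposite to the tangent) winds like the velocity.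
[cite: Hartman2002, Ch. VII Lemma 2.1] -/
theorem wind_eq_wind_deriv_of_div_mem_slitPlane {γ : ℝ → ℂ} {L : ℝ} (hγ : ContDiff ℝ 1 γ)
    (hper : Periodic γ L) (hreg : ∀ t, deriv γ t ≠ 0) {V : ℝ → ℂ} (hV : Continuous V)
    (hVper : Periodic V L) (hslit : ∀ t, V t / deriv γ t ∈ slitPlane) :
    wind (fun u => V (L * u)) = wind (fun u => deriv γ (L * u)) := by
  have hγ'c : Continuous (deriv γ) := hγ.continuous_deriv (by simp)
  have hper' : Periodic (deriv γ) L := periodic_deriv hper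
  have hVne : ∀ t, V t ≠ 0 := fun t h => by
    have := slitPlane_ne_zero (hslit t)
    rw [h, zero_div] at this
    exact this rfl
  have h1 : IsNonvanishingLoop fun u => deriv γ (L * u) :=
    ⟨(hγ'c.comp (continuous_const.mul continuous_id)).continuousOn, fun u _ => hreg _,
      by simp only [mul_zero, mul_one]; have := hper' 0; rw [zero_add] at this; exact this.symm⟩
  have h2 : IsNonvanishingLoop fun u => V (L * u) / deriv γ (L * u) :=
    ⟨((hV.comp (continuous_const.mul continuous_id)).div
        (hγ'c.comp (continuous_const.mul continuous_id)) fun u => hreg _).continuousOn,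
      fun u _ => slitPlane_ne_zero (hslit _), by
        simp only [mul_zero, mul_one]
        have e1 := hper' 0; have e2 := hVper 0
        rw [zero_add] at e1 e2
        rw [e1, e2]⟩
  have h3 : wind (fun u => V (L * u) / deriv γ (L * u)) = 0 :=
    (wind_eq_zero_iff h2).2 ⟨fun u => log (V (L * u) / deriv γ (L * u)),
      h2.continuousOn.clog fun u _ => hslit _, fun u _ => exp_log (slitPlane_ne_zero (hslit _)), by
        simp only [mul_zero, mul_one]
        have e1 := hper' 0; have e2 := hVper 0
        rw [zero_add] at e1 e2
        rw [e1, e2]⟩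
  have h4 := wind_mul h2 h1
  have h5 : (fun u => V (L * u) / deriv γ (L * u) * deriv γ (L * u)) = fun u => V (L * u) :=
    funext fun u => div_mul_cancel₀ _ (hreg _)
  rw [h5, h3, zero_add] at h4
  exact h4

/-- **A field along a `C¹` Jordan loop which is never opposite to the tangent winds once**:
`±1` (Umlaufsatz + deformation lemma; Hartman, *ODE*, Thm. VII.2.1 with Lemma VII.2.1 — the form
in which the Umlaufsatz enters the Poincaré–Bendixson theory, Thm. VII.3.1).
[cite: Hartman2002, Ch. VII Thm. 2.1] -/
theorem wind_eq_one_or_eq_neg_one_of_div_mem_slitPlane {γ : ℝ → ℂ} {L : ℝ} (hL : 0 < L)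
    (hγ : ContDiff ℝ 1 γ) (hper : Periodic γ L)
    (hinj : ∀ ⦃s t : ℝ⦄, γ s = γ t → ∃ m : ℤ, t = s + m * L) (hreg : ∀ t, deriv γ t ≠ 0)
    {V : ℝ → ℂ} (hV : Continuous V) (hVper : Periodic V L) (hslit : ∀ t, V t / deriv γ t ∈ slitPlane) :
    wind (fun u => V (L * u)) = 1 ∨ wind (fun u => V (L * u)) = -1 := by
  rw [wind_eq_wind_deriv_of_div_mem_slitPlane hγ hper hreg hV hVper hslit]
  exact wind_deriv_eq_one_or_eq_neg_one hL hγ hper hinj hreg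

end Literature.Topology.PlaneTopology
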